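import Summits.BirchSwinnertonDyer.Rank1Residual.Additive.RamifiedSevenGenusPartnerFP1
import Literature.NumberTheory.EllipticCurves.Kato2004.EllipticUnitZetaClassComparisonExactScaled
import Literature.NumberTheory.EllipticCurves.Kato2004.DefinedExpStarBodyIsogenyTransportNeron
import HarnessLib

set_option autoImplicit false

/-!
# `𝒞₇` genus road (crux `EllipticUnitValueSevenOfGZK`, K7r), (K-2★) part 1/3 (pen D1166/D1172/D1173): g35's (T5)+(T6) RE-RUN ON
# F-P1-EXACT′ — the two class identities of record at one realised family of the member AND the position bookkeeping (E″)

Cell bsd-cm, seat bsd-cm-k-ty1 g36 (literature-prover; explicit unit, claim-free); pen bsd-cm-plan g39 D1158–D1174, g40 D1175; critic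
idea-crit-15 g19 NOTEs #28–#39.  PURE KERNEL (theorems only): no named fact, no `sorry`, no `instance`, no notation; everything landed is
untouched (g35's `RamifiedSevenGenusPartnerFP1.position_and_member_identity` is re-run with F-P1′ replaced by F-P1-EXACT′ — its statement and
proof are COPIED and extended here, not edited).  The 400-line lint splits (K-2★) into three files: THIS (§0 valuation lemmas + §1 partner
theorem), `…KatoExpUnitLawsPositionOfFP1ExactFrame.lean` (§2 frame-level law with position), `…KatoExpUnitLawsPositionOfFP1Exact.lean` (§3 the
(K-2★) letter at the frame of record); the R-derivation table is in the §2 file's docstring.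

WHAT §1 DOES (beyond g35): keeps the Néron clause (A2) of the member's realised family (`hR`) and TRANSPORTS it to the partner `D₃.W₂` along
the record's `ℚ`-pair `(φ₀, ψ₀)` (`7 ∤ e`, `D₃.e_eq`) by `Kato2004.neronClause_isogeny_transport` (p828320) + (T-A2)′ (p827831); feeds
F-P1-EXACT′ (p828201) at `D₃.W₂` with `⟨d₂, (A1)@W₂, (A2)@W₂⟩`, the endomorphism `φ₂ := β ∘ φ ∘ α` (`φ₂² = [−7e²]`, `cφ := D₃.e`), (hgen)
from the record's GOOD `γ₂` (`φ(α e₁) ≠ 0`, `α ∘ β = [e]`, `gcd(e, 7) = 1` ⇒ `β(φ(α e₁)) ≠ 0`), and the statement's Betti antecedents read through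
`algClosureEmb ι₀ ∘ algebraMap = ι₀` (`K := Kcm`, `sr := (s : Kcm)`, `ι := algClosureEmb ι₀` — on the nose); returns g35's outputs `(M, y, u₁,
w, a₁, a₂, t, α₀, α₁)` with (P), (F) VERBATIM and the new conjunct (E″) `2(a₂ − a₁) + 2t − v₇(α₀² + 7α₁²) = 2·v₇(r) + v₇(Nm κ′)`, from
EXACT′'s (E) `v₇(α₀² + 7α₁²) = 2t + 2e₂ − v₇(Nm κ′)` (`e₂ := v₇(ϖ/(q·q⁻))`, `plusPeriod nf = ϖ·Ω_{W₂}`), `a₂ − a₁ = e₁ := v₇(perRatio/(q·q⁻))`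
(`plusPeriod nf = perRatio·Ω_W`) and `e₁ − e₂ = v₇(perRatio/ϖ) = v₇(r)` for any `r ∈ ℚ` with `r·Ω_W = Ω_{W₂}` (`Ω_W > 0`, so `perRatio = r·ϖ`;
`r ≠ 0` follows from `Ω_{W₂} > 0`, no `r ≠ 0` binder).  §0: the parity lemma `v₇((c₁x)² + 7(c₂y)²) = v₇(x² + 7y²)` (`c₁, c₂ ∈ ℤ₇ˣ`; NOTE #33 (d):
`v(x²)` even, `v(7y²)` odd) with its three `ℤ_p`-valuation helpers.

HONEST LABEL: kernel theorems CONDITIONAL on the displayed named facts (`hFP1x` F-P1-EXACT′, `hTA2` (T-A2)′, `hCMT`, `hMP`, `hLev`) and on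
the stub's `hR`; the Betti data and `r` are ∀-antecedents, NOT shown to exist here (their existence and the bound `R ≤ 2Φ.k + Φ.a` are the
pen's research stub (S-P) = LEMMA P); (S-★′) needs in addition the rigidity (T-R); these files close NO stub by themselves;
stmt-BirchSwinnertonDyer-19945 stays OPEN (zp v22 21191cec33e1747a, 4 sorries); `X12.CMRamifiedSeven` is NOT proved; no summit statement is
proved by this seat; BSD is claimed for no curve.

## References
* K. Kato, Astérisque 295 (2004): Thm. 12.5 (1) (p. 221), §13.9 and Lemma 13.10 (1) (p. 230), Prop. 15.9 (15.9.1) (pp. 258–259), Lemma 15.11 (2)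
  (pp. 261–262), (15.12.1) (p. 263), 15.14 (p. 264), (15.16.1) (p. 265). [Kato2004Asterisque]
* T. Dokchitser, V. Dokchitser, Trans. AMS 367 (2015), §4 Lemma 10–11. [DokchitserDokchitser2015LocalInvariants]
* J. H. Silverman, *AEC* (2009), Thm. VI.5.1, Prop. VI.3.6 (b), C.16. [SilvermanAEC2009]   L. Washington (1997), Thm. 7.3, §13.2. [Washington1997]
* Tree: g35 `Additive/RamifiedSevenGenusPartnerFP1.lean` (p826701), `Additive/RamifiedSevenGenusKatoExpUnitLawsOfFP1.lean` (p826824);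
  `Kato2004/EllipticUnitZetaClassComparisonExactScaled.lean` (p828201), `Kato2004/DefinedExpStarBodyIsogenyTransportNeron.lean` (p828320),
  `DokchitserDokchitser2015/PadicLogIsogenyInvariance.lean` (p827831); zp v22 `Cruxes/EllipticUnitValueSevenOfGZK/Lines/kato_perrin_riou_zp.lean` l.985–1025.
-/

noncomputable section

open scoped NumberField TensorProduct
open WeierstrassCurve Field NumberField IsDedekindDomain
open Literature.NumberTheory.IwasawaTheory
open Literature.NumberTheory.GaloisRepresentations Literature.NumberTheory.GaloisRepresentations.LocalWeilDatum
open Literature.NumberTheory.EllipticCurves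
open Literature.NumberTheory.EllipticCurves.Rank1Residual
open Literature.NumberTheory.EllipticCurves.IwasawaAlgebra
open Literature.NumberTheory.EllipticCurves.Kato2004
open Literature.NumberTheory.EllipticCurves.ModularForms
open Literature.NumberTheory.ComplexMultiplication.EllipticUnits
open Summit.BirchSwinnertonDyer.Rank1Residual

namespace Summit.BirchSwinnertonDyer.Rank1Residual.Additive.GenusSeven

/-! ## §0 Valuation lemmas on `ℤ_p` and the parity of `x² + 7y²` -/

section Valuation

/-- The valuation of a unit of `ℤ_p` is `0`. [folklore] -/
theorem valuation_units_eq_zero {p : ℕ} [Fact p.Prime] (u : ℤ_[p]ˣ) : ((u : ℤ_[p])).valuation = 0 := by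
  have h := PadicInt.norm_eq_zpow_neg_valuation (Units.ne_zero u)
  rw [PadicInt.norm_units] at h
  have hp1 : (1 : ℝ) < p := by exact_mod_cast (Fact.out : p.Prime).one_lt
  have h' := (zpow_eq_one_iff_right₀ (zero_le_one.trans hp1.le) hp1.ne').mp h.symm
  omega

/-- `v(−x) = v(x)` on `ℤ_p`. [folklore] -/
theorem valuation_neg_eq {p : ℕ} [Fact p.Prime] (x : ℤ_[p]) : (-x).valuation = x.valuation := by
  rcases eq_or_ne x 0 with rfl | hx
  · rw [neg_zero]
  rw [← neg_one_mul, PadicInt.valuation_mul (neg_ne_zero.mpr one_ne_zero) hx]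
  have h1 : ((-1 : ℤ_[p])).valuation = 0 := by
    have h := valuation_units_eq_zero (-1 : ℤ_[p]ˣ)
    rwa [Units.val_neg, Units.val_one] at h
  rw [h1, zero_add]

/-- The strict ultrametric equality for `PadicInt.valuation`: `v(x) < v(y)` ⇒ `v(x + y) = v(x)`. [folklore] -/
theorem valuation_add_eq_left_of_lt {p : ℕ} [Fact p.Prime] {x y : ℤ_[p]} (hx : x ≠ 0) (h : x.valuation < y.valuation) :
    (x + y).valuation = x.valuation := by
  have hxy : x + y ≠ 0 := by
    intro h0
    have hyx : y = -x := eq_neg_of_add_eq_zero_right h0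
    rw [hyx, valuation_neg_eq] at h
    exact lt_irrefl _ h
  apply le_antisymm
  · have h2 := PadicInt.le_valuation_add (x := x + y) (y := -y) (by rwa [add_neg_cancel_right])
    rw [add_neg_cancel_right, valuation_neg_eq] at h2
    by_contra hlt
    exact absurd h2 (not_le.mpr (lt_min (not_le.mp hlt) h))
  · have h1 := PadicInt.le_valuation_add hxy
    rwa [min_eq_left h.le] at h1

/-- **Parity of the norm form `x² + 7y²` on `ℤ₇`** (critic NOTE #33 (d)): rescaling the coordinates by `7`-adic units does not change
`v₇(x² + 7y²)` — `v(x²)` is even and `v(7y²)` odd, so the two never cancel and the valuation is `min(2v(x), 2v(y) + 1)` termwise.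
[folklore] -/
theorem valuation_sq_add_seven_mul_sq_units [Fact (Nat.Prime 7)] (c₁ c₂ : ℤ_[7]ˣ) {x y : ℤ_[7]} (h : x ≠ 0 ∨ y ≠ 0) :
    (((c₁ : ℤ_[7]) * x) ^ 2 + 7 * ((c₂ : ℤ_[7]) * y) ^ 2).valuation = (x ^ 2 + 7 * y ^ 2).valuation := by
  have h7 : (7 : ℤ_[7]) ≠ 0 := by norm_num
  have hv7 : (7 : ℤ_[7]).valuation = 1 := by
    have h := PadicInt.valuation_p (p := 7)
    simpa using h
  have hc₁ := valuation_units_eq_zero c₁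
  have hc₂ := valuation_units_eq_zero c₂
  have hc₁0 : (c₁ : ℤ_[7]) ≠ 0 := Units.ne_zero _
  have hc₂0 : (c₂ : ℤ_[7]) ≠ 0 := Units.ne_zero _
  -- the valuations of the four monomials
  have vx1 : ∀ {x : ℤ_[7]}, (x ^ 2).valuation = 2 * x.valuation := fun {x} ↦ PadicInt.valuation_pow x 2
  have vxc : ∀ {x : ℤ_[7]}, x ≠ 0 → (((c₁ : ℤ_[7]) * x) ^ 2).valuation = 2 * x.valuation := fun {x} hx ↦ by
    rw [PadicInt.valuation_pow, PadicInt.valuation_mul hc₁0 hx, hc₁, zero_add]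
  have vy1 : ∀ {y : ℤ_[7]}, y ≠ 0 → (7 * y ^ 2).valuation = 2 * y.valuation + 1 := fun {y} hy ↦ by
    rw [PadicInt.valuation_mul h7 (pow_ne_zero _ hy), hv7, PadicInt.valuation_pow]
    ring
  have vyc : ∀ {y : ℤ_[7]}, y ≠ 0 → (7 * ((c₂ : ℤ_[7]) * y) ^ 2).valuation = 2 * y.valuation + 1 := fun {y} hy ↦ by
    rw [PadicInt.valuation_mul h7 (pow_ne_zero _ (mul_ne_zero hc₂0 hy)), hv7, PadicInt.valuation_pow,
      PadicInt.valuation_mul hc₂0 hy, hc₂, zero_add]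
    ring
  rcases eq_or_ne x 0 with rfl | hx
  · have hy : y ≠ 0 := h.resolve_left (fun h0 ↦ h0 rfl)
    simp only [mul_zero, ne_eq, OfNat.ofNat_ne_zero, not_false_eq_true, zero_pow, zero_add]
    rw [vyc hy, vy1 hy]
  rcases eq_or_ne y 0 with rfl | hy
  · simp only [mul_zero, ne_eq, OfNat.ofNat_ne_zero, not_false_eq_true, zero_pow, add_zero]
    rw [vxc hx, vx1]
  -- both non-zero: even versus odd
  have hne : 2 * x.valuation ≠ 2 * y.valuation + 1 := by omega
  have hX : ((c₁ : ℤ_[7]) * x) ^ 2 ≠ 0 := pow_ne_zero _ (mul_ne_zero hc₁0 hx)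
  have hX1 : x ^ 2 ≠ 0 := pow_ne_zero _ hx
  have hY : 7 * ((c₂ : ℤ_[7]) * y) ^ 2 ≠ 0 := mul_ne_zero h7 (pow_ne_zero _ (mul_ne_zero hc₂0 hy))
  have hY1 : 7 * y ^ 2 ≠ 0 := mul_ne_zero h7 (pow_ne_zero _ hy)
  rcases lt_or_gt_of_ne hne with hlt | hgt
  · rw [valuation_add_eq_left_of_lt hX (by rw [vxc hx, vyc hy]; exact hlt),
      valuation_add_eq_left_of_lt hX1 (by rw [vx1, vy1 hy]; exact hlt), vxc hx, vx1]
  · rw [add_comm, valuation_add_eq_left_of_lt hY (by rw [vxc hx, vyc hy]; exact hgt), add_comm (x ^ 2),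
      valuation_add_eq_left_of_lt hY1 (by rw [vx1, vy1 hy]; exact hgt), vyc hy, vy1 hy]

end Valuation


/-! ## §1 ★★ (T5)+(T6) re-run on F-P1-EXACT′: the two class identities AND the position bookkeeping (E″) -/

namespace PartnerFP1

set_option maxHeartbeats 4000000 in
/-- ★★ **g35's `position_and_member_identity` fed with F-P1-EXACT′ instead of F-P1′** (so the Néron clause (A2) is KEPT and transported to
the partner by `neronClause_isogeny_transport` + (T-A2)′, the endomorphism binder is `φ₂² = [−7·e²]` with `cφ := D₃.e`, (hgen) comes from the
record's good `γ₂`, and EXACT′'s Betti antecedents are those of the statement read through `algClosureEmb ι₀ ∘ algebraMap = ι₀`): the SAME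
outputs `(M, y, u₁, w, a₁, a₂, t, α₀, α₁)` with (P) and (F) as g35 (proof VERBATIM), PLUS the position bookkeeping
(E″) `2(a₂ − a₁) + 2t − v₇(α₀² + 7α₁²) = 2·v₇(r) + v₇(Nm κ′)` — from EXACT′'s (E) `v₇(α₀² + 7α₁²) = 2t + 2e₂ − v₇(Nm κ′)` at the partner,
`a₂ − a₁ = e₁` (the member's (A6′) exponent) and `e₁ − e₂ = v₇(r)` (`perRatio = r·ϖ` since `perRatio·Ω_W = plusPeriod nf = ϖ·Ω_{W₂} = ϖ·r·Ω_W`,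
`Ω_W > 0`).  CONDITIONAL on the displayed named facts `hFP1x`, `hTA2`, `hCMT`, `hMP`, `hLev`.
[cite: Kato2004Asterisque, §15.16 (15.16.1) (p. 265), Lemma 15.11 (2) (pp. 261–262), 15.14 (p. 264), (15.12.1) (p. 263), Thm. 12.5 (1) (p. 221), §13.9 and Lemma 13.10 (1) (p. 230)]
[cite: DokchitserDokchitser2015LocalInvariants, §4 Lemma 10–11] [cite: SilvermanAEC2009, Thm. VI.5.1 and C.16] -/
theorem position_and_member_identity_exact
    (hFP1x : CM.kato15161_ellipticUnitClass_res_zetaFamily_exact')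
    (hTA2 : DokchitserDokchitser2015.padicLogLocal_dual_eq_of_isogenyPair_coprime) (hCMT : CM.artin_natCast_smul_torsion)
    (hMP : nonempty_modularParametrizationData)
    (hLev : ∀ {N : ℕ} [NeZero N], IsNewformOf.level_eq_conductorNorm (N := N))
    {W : WeierstrassCurve ℚ} [W.IsElliptic] [W.IsGloballyMinimal] [Fact (Nat.Prime 7)]
    [ContinuousSMul ℤ_[7] (W.tateModule 7)]
    (K : ZpExtension ℚ 7) (hK : K.IsCyclotomic) {γ : absoluteGaloisGroup ℚ} (hγ : K.IsTopGenerator γ)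
    (I : IwasawaH1Data W 7 K γ) (hR : ∃ z₀ : I.H, IsAdmissibleZetaClass W 7 K hK I z₀)
    {k : ℕ} {zOne : I.H} (hpos : ZetaClassPosition W 7 K hK I k zOne)
    {d : ℕ} (hodd : Odd d) (hbad : ∀ (q : ℕ) [Fact q.Prime], q ≠ 7 → (¬ Good W q ↔ q ∣ d))
    (Kcm : Type) [Field Kcm] [NumberField Kcm] (h2 : Module.finrank ℚ Kcm = 2) (s : 𝓞 Kcm) (hs : (s : Kcm) ^ 2 = -7)
    (ι₀ : Kcm →+* ℂ) (hι₀ : ∀ (w : InfinitePlace Kcm) (x : Kcm), ι₀ x = w.embedding x)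
    [ContinuousSMul ℤ_[7] ((W.baseChange Kcm).tateModule 7)]
    {γK : absoluteGaloisGroup Kcm} (hγK : (K.restrictOfFinrankEqTwo (by decide) Kcm h2).IsTopGenerator γK)
    (IK : IwasawaH1DataOver (W.baseChange Kcm) 7 (K.restrictOfFinrankEqTwo (by decide) Kcm h2) γK)
    (φ : Isogeny (W.baseChange Kcm) (W.baseChange Kcm)) (hφ : ∀ P, φ (φ P) = (-7 : ℤ) • P)
    {𝔣 : Ideal (𝓞 Kcm)} (h𝔣 : 𝔣 ∣ Ideal.span {((7 * d : ℕ) : 𝓞 Kcm)})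
    (D₃ : KummerColumnDataRat W Kcm h2 K IK ι₀ 𝔣 d φ)
    (L : PeriodPair) (hNL : IsNeronLatticeOf (D₃.W₂.baseChange ℂ) L) (lam0 : ℂ)
    (hlam0 : ∀ zz : ℂ, zz ∈ L.lattice ↔ ∃ a : 𝓞 Kcm, zz = lam0 * ι₀ (a : Kcm))
    (κ' : Kcm) (hκ' : ι₀ κ' * ((D₃.W₂.realPeriodRat : ℝ) : ℂ) = ι₀ (s : Kcm) * lam0)
    (r : ℚ) (hr : (r : ℝ) * W.realPeriodRat = D₃.W₂.realPeriodRat) :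
    ∃ (M : IwasawaAlgebra 7) (_ : M ≠ 0) (y : I.H) (u₁ w : (IwasawaAlgebra 7)ˣ) (a₁ a₂ t : ℕ) (α₀ α₁ : ℤ_[7])
      (_ : α₀ ≠ 0 ∨ α₁ ≠ 0),
      (((7 : ℕ) : IwasawaAlgebra 7) ^ a₁ * M) • zOne =
          ((u₁ : IwasawaAlgebra 7) * ((7 : ℕ) : IwasawaAlgebra 7) ^ a₂ * ((7 : ℕ) : IwasawaAlgebra 7) ^ k) • y ∧
      2 * ((a₂ : ℤ) - (a₁ : ℤ)) + 2 * (t : ℤ) - (((α₀ ^ 2 + 7 * α₁ ^ 2).valuation : ℕ) : ℤ) =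
        2 * padicValRat 7 r + padicValRat 7 (Algebra.norm ℚ κ') ∧
      ∀ β : ℕ, 1 < β → β.Coprime (6 * 7 * (7 * d)) → ((7 * d : ℕ) : 𝓞 Kcm) ∣ ((β : ℕ) : 𝓞 Kcm) - 1 →
        ((((β : ℕ) : ℤ) : IwasawaAlgebra 7) * (((7 : ℕ) : IwasawaAlgebra 7) ^ t * M)) • D₃.euK (Ideal.span {((β : ℕ) : 𝓞 Kcm)}) =
          ((Ideal.absNorm (Ideal.span {((β : ℕ) : 𝓞 Kcm)}) : ℕ) : IwasawaAlgebra 7) •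
            (PowerSeries.C (D₃.u : ℤ_[7]) : IwasawaAlgebra 7) •
              (((((β : ℕ) : ℤ) : IwasawaAlgebra 7) -
                  PowerSeries.binomialSeries ℤ_[7]
                    (ZpExtension.artinExponent (K.restrictOfFinrankEqTwo (by decide) Kcm h2) (Ideal.span {((β : ℕ) : 𝓞 Kcm)}))) •
                ((PowerSeries.C α₀ : IwasawaAlgebra 7) • ((w : IwasawaAlgebra 7) • I.resOver IK hγ hγK y) +
                  (PowerSeries.C α₁ : IwasawaAlgebra 7) • (PowerSeries.C (D₃.u : ℤ_[7]) : IwasawaAlgebra 7) •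
                    IK.isogenyMap φ IK hγK ((w : IwasawaAlgebra 7) • I.resOver IK hγ hγK y))) := by
  classical
  -- structure facts of the member and of the partner
  haveI := D₃.isElliptic_W₂
  haveI := D₃.isGloballyMinimal_W₂
  haveI := D₃.continuousSMul_W₂
  haveI : ContinuousSMul ℤ_[7] (D₃.W₂.tateModule 7) := TateModule.continuousSMul_padicInt
  haveI : Module.Free ℤ_[7] (W.tateModule 7) := W.module_free_tateModule_holds 7
  haveI : Module.Finite ℤ_[7] (W.tateModule 7) := W.module_finite_tateModule_holds 7
  haveI : Module.Free ℤ_[7] (D₃.W₂.tateModule 7) := D₃.W₂.module_free_tateModule_holds 7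
  haveI : Module.Finite ℤ_[7] (D₃.W₂.tateModule 7) := D₃.W₂.module_finite_tateModule_holds 7
  haveI : (D₃.W₂.baseChange Kcm).IsElliptic := by
    rw [WeierstrassCurve.baseChange]
    infer_instance
  -- ONE realised family of the member, from `hR` (with its Néron clause (A2))
  obtain ⟨z₀, hz₀⟩ := hR
  obtain ⟨hp, N, hN, nf, hnf, ιcyc, q, Λv, hq, hA12, c, d₁, a, A, d', hA, hc, hd, hdd', hRm, z, x, hZ, y, hy,
    qm, perRatio, e, -, n₁, n₂, n₃, n₄, σc, σd, σℓ, hqm, hspan, h₁, h₂', h₃, h₄, hσc, hσd, hσℓ, hper0, hper, he, -⟩ :=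
    (isAdmissibleZetaClass_iff W 7 K hK I z₀).mp hz₀
  haveI := hN
  -- (P) the ★-position of `zOne`, ∀-eliminated at this family
  obtain ⟨-, u₁, hP⟩ := (zetaClassPosition_iff k zOne).mp hpos hp N hN nf hnf ιcyc q Λv hq hA12 c d₁ a A d' hA hc hd hdd'
    hRm z x hZ y hy qm perRatio e n₁ n₂ n₃ n₄ σc σd σℓ hqm hspan h₁ h₂' h₃ h₄ hσc hσd hσℓ hper0 hper he
  obtain ⟨dg, hDEF, hA2⟩ := hA12
  -- Kato's multiplier of the family is non-zero
  have hM := katoMultiplier_ne_zero 7 W hnf K c d₁ a A d' hqm.ne' h₁ h₂' h₃ h₄ hRm σc σd σℓ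
  -- partner-side bookkeeping
  have he0 : D₃.e ≠ 0 := by rcases D₃.e_eq with h | h <;> simp [h]
  have hd0 : d ≠ 0 := by
    rintro rfl
    exact (Nat.not_odd_iff_even.mpr (by decide)) hodd
  have hf3 : 3 ≤ 7 * d := by omega
  have hmax : D₃.W₂.j ∈ maximalCMJInvariants := by
    rw [D₃.j_W₂]
    simp [maximalCMJInvariants]
  have hKj : IsCMFieldOfJ Kcm D₃.W₂.j := by
    rw [D₃.j_W₂]
    exact MemberGrossencharacter.isCMFieldOfJ_neg3375 Kcm h2 (s : Kcm) hs
  have hL₂ : ∀ zz : ℂ, 3 / 2 < zz.re → heckeLFunction D₃.ψ zz = D₃.W₂.LSeries zz := fun zz hzz ↦ by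
    rw [D₃.ψ_LSeries zz hzz, IsIsogenous.LSeries_eq D₃.isIsogenous]
  have hιC : ∀ (w : InfinitePlace Kcm) (x : Kcm), algClosureEmb ι₀ (algebraMap Kcm (AlgebraicClosure Kcm) x) = w.embedding x :=
    fun w x ↦ by rw [algClosureEmb_algebraMap, hι₀ w x]
  have hsupp : ∀ (ℓ : ℕ) [Fact ℓ.Prime], ℓ ∣ 7 * d → ℓ ≠ 7 → ¬ D₃.W₂.HasGoodReductionAtPrime ℓ := by
    intro ℓ hℓ hdvd hℓ7 hgood
    have hℓd : ℓ ∣ d := by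
      rcases (Nat.Prime.dvd_mul hℓ.out).mp hdvd with h7 | h
      · exact absurd ((Nat.prime_dvd_prime_iff_eq hℓ.out (by norm_num)).mp h7) hℓ7
      · exact h
    exact ((hbad ℓ hℓ7).mpr hℓd) ((IsIsogenous.hasGoodReductionAtPrime_iff D₃.isIsogenous ℓ).mpr hgood)
  have h₀ := ZpExtension.surjective_comp_absGaloisRestrict_of_finrank_eq_two (p := 7) (by decide) K Kcm h2
  -- the Kummer frame of the partner, its non-vanishing witness, and the cyclotomic layers inside its levels
  have heF : ∃ kk, (KummerFrame.ofTorsionTower (D₃.W₂.baseChange Kcm) 7 (7 * d) D₃.hf D₃.γ₂).e kk ≠ 0 :=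
    ⟨1, fun h0 ↦ D₃.good (by rw [h0, ZeroMemClass.coe_zero, map_zero, map_zero])⟩
  have hV : ∀ n : ℕ, (KummerFrame.ofTorsionTower (D₃.W₂.baseChange Kcm) 7 (7 * d) D₃.hf D₃.γ₂).V (n + 1) ≤
      (K.restrict Kcm h₀).layerSubgroup n := fun n ↦
    torsionLayer_succ_le_layerSubgroup h2 K hK (D₃.W₂.baseChange Kcm) d n
  -- the CM endomorphism of the partner `φ₂ := β ∘ φ ∘ α`, `φ₂² = [−7e²]`
  have hφ₂sq : ∀ P, (D₃.β.comp (φ.comp D₃.α)) ((D₃.β.comp (φ.comp D₃.α)) P) = (-7 * D₃.e ^ 2 : ℤ) • P := fun P ↦ by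
    simp only [Isogeny.comp_apply]
    rw [D₃.αβ, map_zsmul, hφ, map_zsmul, map_zsmul, D₃.βα, smul_smul, smul_smul]
    congr 1
    ring
  have hm : (-7 * D₃.e ^ 2 : ℤ) < 0 := by rcases D₃.e_eq with h | h <;> rw [h] <;> norm_num
  -- the newform and the period ratio of the partner (catalogued facts)
  have hnf₂ : IsNewformOf D₃.W₂ nf := hnf.of_isIsogenous ⟨D₃.ψ₀⟩
  obtain ⟨ϖ, hϖ0, hϖ⟩ := exists_ne_zero_rat_mul_realPeriodRat_eq_plusPeriod_of_facts hMP hLev D₃.W₂ nf hnf₂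
  -- (A1), (A3), (A4) transported along the `ℚ`-pair `(φ₀, ψ₀)` of the record
  obtain ⟨d₂, hi₂, hDEF₂⟩ :=
    definedExpStarBody_isogeny_transport W D₃.W₂ 7 nf ιcyc ((q : ℚ) : ℝ) Λv D₃.φ₀ D₃.ψ₀ he0 D₃.ψφ hDEF
  -- (A2) transported along `(φ₀, ψ₀)`: (T-A2)′ + the kernel transport of the Néron clause (p828320)
  have h7e : ¬ ((7 : ℕ) : ℤ) ∣ D₃.e := by rcases D₃.e_eq with h | h <;> rw [h] <;> norm_num
  have hA2₂ := neronClause_isogeny_transport hTA2 W D₃.W₂ 7 D₃.φ₀ D₃.ψ₀ D₃.ψφ D₃.φψ h7e dg d₂ hi₂ hA2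
  have hZ₂ := ZetaBody.isogeny_transport 7 nf ιcyc ((q : ℚ) : ℝ) Λv c d₁ a A z x D₃.φ₀ D₃.ψ₀ he0 D₃.ψφ hZ
  have hy₂ : ∀ n : ℕ, (D₃.transportI I).proj n y = levelToLayer D₃.W₂ 7 hK hp (EulerSystemValues.badPlaces c d₁ A N) n
      (isogenyMapH1 7 D₃.φ₀ ((cyclotomicLevelsRat 7 (EulerSystemValues.badPlaces c d₁ A N)).level (n + 1) ∅)
        (z (n + 1) (cyclotomicLevelsRat 7 (EulerSystemValues.badPlaces c d₁ A N)).idealOne)) := fun n ↦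
    PartnerTransport.transportQ_proj_eq_levelToLayer hK hp I D₃.φ₀ D₃.ψ₀ D₃.e D₃.u D₃.u_eq D₃.ψφ D₃.φψ
      (EulerSystemValues.badPlaces c d₁ A N) (fun n ↦ z (n + 1) (cyclotomicLevelsRat 7 (EulerSystemValues.badPlaces c d₁ A N)).idealOne) hy n
  -- (hgen) at the partner: `φ₂(e₁) ≠ 0` from the record's GOOD `γ₂` (`φ(α e₁) ≠ 0`), `α ∘ β = [e]` and `gcd(e, 7) = 1`
  have hgen₂ : (D₃.β.comp (φ.comp D₃.α))
      (((KummerFrame.ofTorsionTower (D₃.W₂.baseChange Kcm) 7 (7 * d) D₃.hf D₃.γ₂).e 1 :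
        geomTorsion (D₃.W₂.baseChange Kcm) ((7 : ℤ) ^ 1)) : geomPoints (D₃.W₂.baseChange Kcm)) ≠ 0 := by
    intro h0
    rw [Isogeny.comp_apply, Isogeny.comp_apply] at h0
    have hx0 := D₃.good
    set P₁ := φ (D₃.α (((KummerFrame.ofTorsionTower (D₃.W₂.baseChange Kcm) 7 (7 * d) D₃.hf D₃.γ₂).e 1 :
        geomTorsion (D₃.W₂.baseChange Kcm) ((7 : ℤ) ^ 1)) : geomPoints (D₃.W₂.baseChange Kcm))) with hP₁
    have h7x' : (((7 : ℕ) : ℤ) ^ 1) • P₁ = 0 := by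
      rw [hP₁, ← map_zsmul, ← map_zsmul,
        (mem_geomTorsion_iff _ _ _).mp ((KummerFrame.ofTorsionTower (D₃.W₂.baseChange Kcm) 7 (7 * d) D₃.hf D₃.γ₂).e 1).2,
        map_zero, map_zero]
    have h7x : (7 : ℤ) • P₁ = 0 := by simpa only [pow_one, Nat.cast_ofNat] using h7x'
    have hex : D₃.e • P₁ = 0 := by rw [← D₃.αβ P₁, h0, map_zero]
    apply hx0
    rcases D₃.e_eq with h1 | h2
    · rwa [h1, one_zsmul] at hex
    · rw [h2] at hex
      calc P₁ = (7 : ℤ) • P₁ - (3 : ℤ) • ((2 : ℤ) • P₁) := by rw [smul_smul, ← sub_smul]; norm_num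
        _ = 0 := by rw [h7x, hex, smul_zero, sub_zero]
  -- the Betti antecedents of EXACT′ at the partner, read through `algClosureEmb ι₀ ∘ algebraMap = ι₀`
  have hs7 : ((s : Kcm)) ^ 2 = -((7 : ℕ) : Kcm) := by rw [hs]; norm_num
  have hlam0' : ∀ zz : ℂ, zz ∈ L.lattice ↔
      ∃ a : 𝓞 Kcm, zz = lam0 * algClosureEmb ι₀ (algebraMap Kcm (AlgebraicClosure Kcm) ((a : Kcm))) := fun zz ↦ by
    simp only [algClosureEmb_algebraMap]
    exact hlam0 zz
  have hκ'' : algClosureEmb ι₀ (algebraMap Kcm (AlgebraicClosure Kcm) κ') * ((D₃.W₂.realPeriodRat : ℝ) : ℂ) =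
      algClosureEmb ι₀ (algebraMap Kcm (AlgebraicClosure Kcm) (s : Kcm)) * lam0 := by
    rw [algClosureEmb_algebraMap, algClosureEmb_algebraMap]
    exact hκ'
  have hm' : (-7 * D₃.e ^ 2 : ℤ) = -((7 : ℕ) : ℤ) * D₃.e ^ 2 := by push_cast; ring
  -- F-P1-EXACT′ at the partner (with its Néron clause (A2) and its Betti antecedents)
  obtain ⟨t, α₀, α₁, hα, w, HF, HE⟩ := hFP1x D₃.W₂ hmax Kcm hKj D₃.ψ D₃.ψ_infinityType hL₂ (algClosureEmb ι₀) hιC (7 * d) hf3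
    D₃.ψ_conductor 7 hsupp K hK γ hγ (D₃.transportI I) h₀ γK hγK (D₃.transportIK IK)
    (KummerFrame.ofTorsionTower (D₃.W₂.baseChange Kcm) 7 (7 * d) D₃.hf D₃.γ₂)
    (KummerFrame.ofTorsionTower_V (D₃.W₂.baseChange Kcm) 7 (7 * d) D₃.hf D₃.γ₂) heF hV
    (D₃.β.comp (φ.comp D₃.α)) (-7 * D₃.e ^ 2) hm hφ₂sq D₃.e h7e hm' hgen₂ L hNL lam0 hlam0' (s : Kcm) hs7 κ' hκ''
    hp N hN nf hnf₂ ιcyc q _ hq ⟨d₂, hDEF₂, hA2₂⟩ c d₁ a A d' hA hc hd hdd'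
    hRm _ x hZ₂ y hy₂ qm ϖ (padicValRat 7 (ϖ / (q * qm))) n₁ n₂ n₃ n₄ σc σd σℓ hqm hspan h₁ h₂' h₃ h₄ hσc hσd hσℓ
    hϖ0 hϖ.symm rfl
  -- the Euler factors of the partner are the member's
  rw [IsIsogenous.LFunction_eq D₃.isIsogenous] at hM hP
  refine ⟨_, hM, y, u₁, w, (-e).toNat, e.toNat, t, α₀, α₁, hα, hP, ?_, fun β hβ hβc hβf ↦ ?_⟩
  · -- (E″): EXACT′'s clause (E) at the partner re-read on the member's (A6′) exponent: `2(a₂ − a₁) + 2t − v(α₀²+7α₁²) = 2v₇(r) + v₇(Nm κ′)`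
    have hΩW : (0 : ℝ) < W.realPeriodRat := W.realPeriodRat_pos_holds
    have hΩ₂ : (0 : ℝ) < D₃.W₂.realPeriodRat := D₃.W₂.realPeriodRat_pos_holds
    have hr0 : r ≠ 0 := by
      rintro rfl
      rw [Rat.cast_zero, zero_mul] at hr
      exact hΩ₂.ne hr
    have hpr : perRatio = r * ϖ := by
      have h1 : ((perRatio : ℚ) : ℝ) * W.realPeriodRat = ((r * ϖ : ℚ) : ℝ) * W.realPeriodRat := by
        rw [← hper, ← hϖ, ← hr]
        push_cast
        ring
      exact_mod_cast mul_right_cancel₀ hΩW.ne' h1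
    have hϖqq : ϖ / (q * qm) ≠ 0 := div_ne_zero hϖ0 (mul_ne_zero hq hqm.ne')
    have hval : padicValRat 7 (perRatio / (q * qm)) = padicValRat 7 r + padicValRat 7 (ϖ / (q * qm)) := by
      rw [hpr, mul_div_assoc, padicValRat.mul hr0 hϖqq]
    have htn : ((e.toNat : ℕ) : ℤ) - (((-e).toNat : ℕ) : ℤ) = e := Int.toNat_sub_toNat_neg e
    simp only [Nat.cast_ofNat] at HE
    linarith [HE, hval, htn, he]
  -- the rational twist `(β)`, its unit tower of Kato representatives, its coordinates `(β, 0, 1)` by (CMT-ℤ)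
  have hTw : IsTwist 7 𝔣 (Ideal.span {((β : ℕ) : 𝓞 Kcm)}) := isTwist_span_natCast h2 h𝔣 hβ hβc
  obtain ⟨uT, huT, -, hcol⟩ := D₃.column (Ideal.span {((β : ℕ) : 𝓞 Kcm)}) hTw
  have hcop : IsCoprime (Ideal.span {((β : ℕ) : 𝓞 Kcm)}) (Ideal.span {((6 * 7 * (7 * d) : ℕ) : 𝓞 Kcm)}) :=
    (Ideal.isCoprime_span_singleton_iff _ _).mpr hβc.cast
  have H := HF (Ideal.span {((β : ℕ) : 𝓞 Kcm)}) hcop uT huT (β : ℤ) 0 1 one_ne_zero fun kk ss hks hss ↦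
    hCMT.hε_shape D₃.W₂ hmax Kcm hKj D₃.ψ D₃.ψ_infinityType hL₂ (algClosureEmb ι₀) hιC (7 * d) hf3 D₃.ψ_conductor 7 β hβ
      hβc hβf (⇑(D₃.β.comp (φ.comp D₃.α))) kk ss hks hss _
  simp only [Int.cast_zero, zero_mul, zero_smul, add_zero, Nat.cast_one, one_mul] at H
  -- back to the member's carrier: `res₂ = res`, `(φ₂)_* = C(e) • φ_*`, `euK (β) = C(e) • 𝐳(u)`
  have hres : (D₃.transportI I).resOver (D₃.transportIK IK) hγ hγK y = I.resOver IK hγ hγK y :=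
    D₃.resOver_transportI_transportIK hγ hγK I IK y
  have hφ₂T : ∀ xx : IK.H,
      IwasawaH1DataOver.isogenyMap (κ := K.restrict Kcm h₀) (D₃.β.comp (φ.comp D₃.α)) (D₃.transportIK IK) (D₃.transportIK IK)
          hγK xx =
        (PowerSeries.C (D₃.u : ℤ_[7]) : IwasawaAlgebra 7) • IK.isogenyMap φ IK hγK xx := fun xx ↦
    PartnerTransport.transport_isogenyMap_comp_eq_C_smul IK D₃.β D₃.α D₃.e D₃.u D₃.u_eq D₃.αβ D₃.βα hγK φ xx
  -- (the left-hand side below is elaborated on the transported carrier, as in F-P1′'s conclusion)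
  have heu : (PowerSeries.C (D₃.u : ℤ_[7]) : IwasawaAlgebra 7) •
      KummerFrame.iwasawaClass _ uT (K.restrict Kcm h₀) hV (D₃.transportIK IK) = D₃.euK (Ideal.span {((β : ℕ) : 𝓞 Kcm)}) := by
    have h1 : D₃.euK (Ideal.span {((β : ℕ) : 𝓞 Kcm)}) =
        (D₃.transportIK IK).isogenyMap D₃.α IK hγK (KummerFrame.iwasawaClass _ uT (K.restrict Kcm h₀) hV (D₃.transportIK IK)) :=
      (D₃.transportIK IK).eq_isogenyMap_of_proj_eq D₃.α IK hγK fun n ↦ by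
        rw [hcol n]
        exact congrArg _ (KummerFrame.proj_iwasawaClass_eq_tateClass _ uT (K.restrict Kcm h₀) hV (D₃.transportIK IK) n).symm
    exact (h1.trans (PartnerTransport.transport_isogenyMap_eq_C_smul IK D₃.β D₃.α D₃.e D₃.u D₃.u_eq D₃.αβ D₃.βα hγK _)).symm
  rw [hres, hφ₂T] at H
  have H' := congrArg (fun v ↦ (PowerSeries.C (D₃.u : ℤ_[7]) : IwasawaAlgebra 7) • v) H
  rw [smul_smul, mul_comm (PowerSeries.C (D₃.u : ℤ_[7]) : IwasawaAlgebra 7), ← smul_smul, heu,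
    smul_comm (PowerSeries.C (D₃.u : ℤ_[7]) : IwasawaAlgebra 7)
      ((Ideal.absNorm (Ideal.span {((β : ℕ) : 𝓞 Kcm)}) : ℕ) : IwasawaAlgebra 7)] at H'
  exact H'

end PartnerFP1

end Summit.BirchSwinnertonDyer.Rank1Residual.Additive.GenusSeven

end
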